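import Literature.NumberTheory.EllipticCurves.NeronModelCodimOne
import HarnessLib

/-!
# Weil's extension theorem: the domain of definition of the rational map and its maximal
# extension

Infrastructure towards the named fact
`Literature.NumberTheory.EllipticCurves.isNeronModel_of_abelianScheme` (Artin, *Néron Models*,
Cor. (1.4): "Valuative criterion and Proposition (1.3)"), continuing `NeronModelCodimOne`.
Setting: `R` a discrete valuation ring with fraction field `K`, `𝒳 → Spec R` smooth with integral
total space `X`, `𝒜 → Spec R` separated (and proper, for the codimension-one statement),
`U ⊆ X` a dense open containing the generic fibre and `g : U → 𝒜` an `R`-morphism. The rational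
map `φ` defined by `g` (Mathlib `Scheme.PartialMap.toRationalMap`) has a largest domain of
definition `Dφ` (Mathlib `Scheme.RationalMap.domain`) carrying a morphism `gφ : Dφ → 𝒜`
(Mathlib `Scheme.RationalMap.toPartialMap`; `X` reduced, `𝒜` separated). This file collects the
properties of `(Dφ, gφ)` used in the proof of Weil's extension theorem (Artin, Prop. (1.3);
Liu, *Algebraic Geometry and Arithmetic Curves*, Thm. 10.2.15):

* `isSeparated_left` — the total space of a separated `R`-scheme is separated;
* `homOfLE_extHom` — `gφ` restricts to `g` on `U ⊆ Dφ`;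
* `extHom_comp_hom` — `gφ` is an `R`-morphism;
* (`NeronModelCodimOne.mem_domain_of_ringKrullDim_le_one` — every point `x` with
  `dim 𝒪_{X,x} ≤ 1` lies in `Dφ`, by the valuative criterion, for `𝒜` proper;)
* `mem_extDomain_of_agree` — a point `x` lies in `Dφ` as soon as some morphism `v : V → 𝒜` on an
  open `V ∋ x` agrees with `g` on `V ∩ U`;
* `exists_hom_of_extDomain_eq_top` — if `Dφ = X` then `g` extends to an `R`-morphism `X → 𝒜`.

So Weil's theorem — `g` extends — amounts to `Dφ = X`, i.e. to showing that every point of `X`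
admits a neighbourhood with a morphism to `𝒜` agreeing with `g` on `U`.

No named facts or definitions are introduced (D-0026); everything here is proved.

## References

* M. Artin, *Néron Models*, in Cornell–Silverman (eds.), *Arithmetic Geometry*, Springer 1986,
  (1.1), Prop. (1.3), Cor. (1.4) (pp. 213–215). [Artin1986NeronModels]
* Q. Liu, *Algebraic Geometry and Arithmetic Curves*, OUP 2002, §10.2.2, Thm. 2.15 (p. 494).
  [Liu2002]
* J. S. Milne, *Abelian Varieties*, in Cornell–Silverman (eds.), *Arithmetic Geometry*, §3
  ("There is a largest open subset `U` of `V` such that `f` defines a morphism `U → W`").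
  [Milne1986AbelianVarieties]
-/

noncomputable section

universe u

namespace Literature.NumberTheory.EllipticCurves

open _root_.AlgebraicGeometry CategoryTheory Limits

/-! ### Separatedness of the total space -/

section Separated

variable {S : Scheme.{u}} [S.IsSeparated]

/-- The total space of a separated scheme over a separated base (e.g. an affine base) is
separated. [folklore] -/
theorem isSeparated_left (𝒜 : Over S) [IsSeparated 𝒜.hom] : 𝒜.left.IsSeparated := by
  constructor
  rw [show terminal.from 𝒜.left = 𝒜.hom ≫ terminal.from S from terminal.hom_ext _ _]
  infer_instance

end Separated

/-! ### The maximal extension `(Dφ, gφ)` of the rational map defined by `g : U → 𝒜` -/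

section Domain

variable {R : Type u} [CommRing R] {𝒜 𝒳 : Over (Spec (.of R))} [IsSeparated 𝒜.hom]
  [IsIntegral 𝒳.left] (U : 𝒳.left.Opens) (hUd : Dense (U : Set 𝒳.left))
  (g : (U : Scheme.{u}) ⟶ 𝒜.left)

/-- `U` is contained in the domain of definition `Dφ` of the rational map defined by `g : U → 𝒜`
(typed with the domain of the maximal partial map). [folklore] -/
theorem le_extDomain :
    haveI := isSeparated_left 𝒜
    U ≤ ((Scheme.PartialMap.toRationalMap ⟨U, hUd, g⟩).toPartialMap).domain :=
  Scheme.PartialMap.le_domain_toRationalMap (⟨U, hUd, g⟩ : 𝒳.left.PartialMap 𝒜.left)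

/-- The domain of the maximal partial map is the domain of definition of the rational map
(by construction). [folklore] -/
theorem extDomain_eq :
    haveI := isSeparated_left 𝒜
    ((Scheme.PartialMap.toRationalMap ⟨U, hUd, g⟩).toPartialMap).domain =
      (Scheme.PartialMap.toRationalMap ⟨U, hUd, g⟩).domain := rfl

/-- The morphism `gφ` on the domain of definition `Dφ` of the rational map defined by
`g : U → 𝒜` restricts to `g` on `U` (Mathlib `Scheme.PartialMap.toPartialMap_toRationalMap_restrict`).
[folklore] -/
theorem homOfLE_extHom :
    haveI := isSeparated_left 𝒜
    𝒳.left.homOfLE (le_extDomain U hUd g) ≫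
      ((Scheme.PartialMap.toRationalMap ⟨U, hUd, g⟩).toPartialMap).hom = g := by
  haveI := isSeparated_left 𝒜
  have h := Scheme.PartialMap.toPartialMap_toRationalMap_restrict
    (⟨U, hUd, g⟩ : 𝒳.left.PartialMap 𝒜.left)
  rwa [Scheme.PartialMap.restrict_hom] at h

/-- The morphism `gφ` on the domain of definition `Dφ` is a morphism over `Spec R` if `g` is:
both `gφ ≫ 𝒜.hom` and the structure map `Dφ → Spec R` agree on the dense open `U ⊆ Dφ` of the
reduced scheme `Dφ`, and `Spec R` is separated. [folklore] -/
theorem extHom_comp_hom (hg : g ≫ 𝒜.hom = U.ι ≫ 𝒳.hom) :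
    haveI := isSeparated_left 𝒜
    ((Scheme.PartialMap.toRationalMap ⟨U, hUd, g⟩).toPartialMap).hom ≫ 𝒜.hom =
      ((Scheme.PartialMap.toRationalMap ⟨U, hUd, g⟩).toPartialMap).domain.ι ≫ 𝒳.hom := by
  haveI := isSeparated_left 𝒜
  haveI : IsDominant (𝒳.left.homOfLE (le_extDomain U hUd g)) :=
    Opens.isDominant_homOfLE hUd _
  refine ext_of_isDominant (𝒳.left.homOfLE (le_extDomain U hUd g)) ?_
  rw [← Category.assoc, homOfLE_extHom U hUd g, hg, ← Category.assoc, Scheme.homOfLE_ι]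

omit [IsSeparated 𝒜.hom] in
/-- A point `x` lies in the domain of definition `Dφ` of the rational map defined by `g : U → 𝒜`
as soon as there are an open `V ∋ x` and a morphism `v : V → 𝒜` agreeing with `g` on `V ∩ U`
(the partial maps `(V, v)` and `(U, g)` are then equivalent). [folklore] -/
theorem mem_extDomain_of_agree {x : 𝒳.left} (V : 𝒳.left.Opens) (hxV : x ∈ V)
    (v : (V : Scheme.{u}) ⟶ 𝒜.left)
    (hv : 𝒳.left.homOfLE (inf_le_left : V ⊓ U ≤ V) ≫ v =
      𝒳.left.homOfLE (inf_le_right : V ⊓ U ≤ U) ≫ g) :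
    x ∈ (Scheme.PartialMap.toRationalMap ⟨U, hUd, g⟩).domain := by
  have hVd : Dense (V : Set 𝒳.left) := V.2.dense ⟨x, hxV⟩
  let ψ : 𝒳.left.PartialMap 𝒜.left := ⟨V, hVd, v⟩
  have heq : ψ.toRationalMap = Scheme.PartialMap.toRationalMap ⟨U, hUd, g⟩ :=
    Scheme.PartialMap.toRationalMap_eq_iff.mpr
      ⟨V ⊓ U, hVd.inter_of_isOpen_left hUd V.2, inf_le_left, inf_le_right, by
        rw [Scheme.PartialMap.restrict_hom, Scheme.PartialMap.restrict_hom]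
        exact hv⟩
  exact Scheme.RationalMap.mem_domain.mpr ⟨ψ, hxV, heq⟩

/-- If the domain of definition of the rational map defined by the `R`-morphism `g : U → 𝒜` is
all of `X`, then `g` extends to an `R`-morphism `X → 𝒜`. [folklore] -/
theorem exists_hom_of_extDomain_eq_top (hg : g ≫ 𝒜.hom = U.ι ≫ 𝒳.hom)
    (htop : (Scheme.PartialMap.toRationalMap ⟨U, hUd, g⟩).domain = ⊤) :
    ∃ f : 𝒳.left ⟶ 𝒜.left, f ≫ 𝒜.hom = 𝒳.hom ∧ U.ι ≫ f = g := by
  haveI := isSeparated_left 𝒜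
  have htop' : ((Scheme.PartialMap.toRationalMap ⟨U, hUd, g⟩).toPartialMap).domain = ⊤ := htop
  let gφ : (((Scheme.PartialMap.toRationalMap ⟨U, hUd, g⟩).toPartialMap).domain : Scheme.{u}) ⟶
      𝒜.left := ((Scheme.PartialMap.toRationalMap ⟨U, hUd, g⟩).toPartialMap).hom
  have hgφ : gφ ≫ 𝒜.hom =
      ((Scheme.PartialMap.toRationalMap ⟨U, hUd, g⟩).toPartialMap).domain.ι ≫ 𝒳.hom :=
    extHom_comp_hom U hUd g hg
  have hUφ : 𝒳.left.homOfLE (le_extDomain U hUd g) ≫ gφ = g := homOfLE_extHom U hUd g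
  refine ⟨𝒳.left.topIso.inv ≫ (𝒳.left.isoOfEq htop').inv ≫ gφ, ?_, ?_⟩
  · rw [Category.assoc, Category.assoc, hgφ, Scheme.isoOfEq_inv_ι_assoc, ← Category.assoc,
      Scheme.toIso_inv_ι, Category.id_comp]
  · have e : U.ι ≫ 𝒳.left.topIso.inv ≫ (𝒳.left.isoOfEq htop').inv =
        𝒳.left.homOfLE (le_extDomain U hUd g) := by
      rw [← cancel_mono ((Scheme.PartialMap.toRationalMap ⟨U, hUd, g⟩).toPartialMap).domain.ι,
        Category.assoc, Category.assoc, Scheme.isoOfEq_inv_ι, Scheme.homOfLE_ι]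
      change U.ι ≫ 𝒳.left.topIso.inv ≫ 𝒳.left.topIso.hom = U.ι
      rw [Iso.inv_hom_id, Category.comp_id]
    rw [← Category.assoc U.ι, ← Category.assoc, Category.assoc U.ι, e]
    exact hUφ

end Domain



end Literature.NumberTheory.EllipticCurves

end
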